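import Summits.Ventures.CertifiedManyBodySolver.Downfold.EmeryBandJetWindow
import HarnessLib

/-!
# ONE-SIDED JET CERTIFICATES (t′_J/t_J ceiling, margin 0.003) on (sub-cell × two-corner bracket) for 4_3_0_1_0, 4_3_0_1_1 (INFL-3to1-B §B.101 (d); 66 leaf evaluations)

Venture CertifiedManyBodySolver, cell `pub/hubbard-downfold` (stage S1; INFLATION-RULES-3to1-B §B.101 (d)), seat hubbard-downfold-mod-4 (technique B, g45); namespace `Summit.Ventures.CertifiedManyBodySolver.Downfold.Emery`.
Everything PROVED (`decide +kernel`). THE SIGN OF OBJECT M's t′: the 8 cells of the 8×4×2 grid of `EmeryBoxesLa214JetCellX0*` whose t′_J/t_J ceiling was ≥ −0.002 (all at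
t_pp ∈ [0.46, 0.56], high t_pd) are refined 2×2 in (Δ_pd, t_pd) with their own K = 384 two-corner ε_F brackets; the jet certificates are one-sided tight (t′ ceiling
margin 0.003, other faces loose). WHAT THIS IS NOT: a statement about La₂CuO₄ (SCREENING-GRADE box `emeryBoxLa214v123`); `U = 0` σ kinematics; an outer bound still.
-/

noncomputable section

namespace Summit.Ventures.CertifiedManyBodySolver.Downfold.Emery

open Real Set Literature.Analysis.ValidatedNumerics.Numerics

set_option maxRecDepth 16384 in
/-- Sub-cell 4_3_0_1_0, piece 0 (root; 33 leaf evaluations). [folklore] -/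
theorem la214X0Sub_4_3_0_1_0_c0 :
    Box5.deep (jetLeaf ⟨93308954779582, 133278401472496, -26909007773539, -3799912185593, 9401264222135, 44782668794666⟩) 40
      ⟨fiIcc 479 160 251 80, fiIcc 117 80 1193 800, fiIcc 23 50 14 25, fiIcc 3 25 3 20, fiIcc 1084 625 18927 10000⟩ = true := by
  decide +kernel

set_option maxRecDepth 16384 in
/-- Sub-cell 4_3_0_1_1, piece 0 (root; 33 leaf evaluations). [folklore] -/
theorem la214X0Sub_4_3_0_1_1_c0 :
    Box5.deep (jetLeaf ⟨95588902090938, 135558348783852, -26120877838749, -3096224743817, 9513854212820, 44923406283021⟩) 40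
      ⟨fiIcc 479 160 251 80, fiIcc 1193 800 38 25, fiIcc 23 50 14 25, fiIcc 3 25 3 20, fiIcc 17843 10000 19443 10000⟩ = true := by
  decide +kernel

end Summit.Ventures.CertifiedManyBodySolver.Downfold.Emery
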